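import Summits.Ventures.Crystal3D.Theorems.StickyWulffConstantStackingLiminfRefinedProfile
import Summits.Ventures.Crystal3D.Theorems.StickyWulffConstantStackingLiminfRefinedProfileSharp
import Summits.Ventures.Crystal3D.Theorems.StickyWulffConstantStackingLiminfRefinedBound
import Summits.Ventures.Crystal3D.Theorems.StickyWulffConstantStackingLiminfCalibrationCap
import Summits.Ventures.Crystal3D.Theorems.StickyWulffConstantStackingLiminfOptimalCalibrationValue
import HarnessLib

/-!
# The CALIBRATED PROFILE BOUND (generic `c, δ`) behind the word-uniform surface rungs `∛338` /
# `∛369` — crux `StackingLiminf` (stmt-Ventures-19145), rung ladder (cf-p2 R20 optimal-shape calibration)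

Route `StickyWulffConstant` of the venture `Summits/Ventures/Crystal3D` (cell `crystal3d-full`).
For every Hägg word `σ` and every injective `N`-configuration on `barlowStacking 1 √(2/3) σ`:
`numContacts ≤ 6N − min(3N/5, K·N^{2/3} − K'·√N)` with `K³ ≥ 338` from `layerProfile`
(`(c, δ) = (1, 0)`) and `K³ ≥ 369` from `layerProfileSharp` (`(c, δ) = (√2, 1/2)`), hence the
ε-forms `(∛338 − ε)N^{2/3}` (`= 6.966`) and `(∛369 − ε)N^{2/3}` (`= 7.173`, 94.9 % of the crux's
`∛432 = 7.5595`) eventually, uniformly in `σ` — improving the landed `∛320 = 6.84` (p462749).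
Assembly = `profile_bound` of `…RefinedBound.lean` with `interface_calibration_cap` (cf-p2's
δ-generalised calibration) and the dual `thetaW/Psi/Psi2/G` of `…OptimalCalibrationDefs`, the value
estimate `two_mul_G_top_ge` (B = 3 − 2c/β_c, tangent-line form) and `omega_ge`; regimes `M ≤ 30`
(`∑ d ≥ 3N/5`) / `M ≥ 31` (calibration with `ω ≥ ω₃₁ := β_c − κ_c/√31`).
The ladder's exact ceiling with the integral form of L5 is `7.0324 / 7.3544` (cf-p2 R20); this file
does not reach it.  WHAT THIS IS NOT: `StackingLiminf` (∛432); nothing about which stacking is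
optimal; rung F-C1 not moved.
-/

noncomputable section

namespace Summit.Ventures.Crystal3D.Theorems.OptimalCalibration

open Finset
open Literature.MathematicalPhysics.StatisticalMechanics (barlowStacking IsHaggSeq)
open Summit.Ventures.Crystal3D.Theorems

/-- `Ψ₂(0) = 0`. -/
theorem Psi2_zero (c δ : ℝ) (M : ℕ) : Psi2 c δ M 0 = 0 := by simp [Psi2]

/-- **The calibrated profile bound** (generic `c, δ`).  From the data of `layerProfile`-type
(any `C` with `C + ∑ d + ∑ b ≤ 6N`, shallow interface bound `(1/2)|Δ| + c√max − δ ≤ b`):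
`C ≤ 6N − min(3N/5, (27 ω₃₁² B/4)^{1/3} N^{2/3} − K'√N)` with
`ω₃₁ = 2√3 + c − (δ + √3/(2√31))/√31`, `B = 3 − 2c/(2√3 + c)`,
`K' = 2√3/c + c + 2 + (2√3 + c)/(2c)`. -/
theorem profile_bound_cal {N : ℕ} (hN : 0 < N) {c δ : ℝ} (hc : 0 < c) (hc2 : c ≤ 2)
    (hδ : 0 ≤ δ) (hδc : δ ≤ c) (hδ2 : δ * (2 + c / 2) ≤ c ^ 2)
    {C : ℝ} {kmin kmax : ℤ} {n : ℤ → ℕ} {d b : ℤ → ℝ}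
    (hkk : kmin ≤ kmax) (hsupp : ∀ κ, n κ ≠ 0 → kmin ≤ κ ∧ κ ≤ kmax)
    (hsum : ∑ κ ∈ Finset.Icc kmin kmax, n κ = N) (hd0 : ∀ κ, n κ = 0 → d κ = 0)
    (hd : ∀ κ, 0 ≤ d κ ∧ 12 * (n κ : ℝ) ≤ d κ ^ 2 + 3)
    (hb1 : ∀ κ, 3 / 2 * |(n κ : ℝ) - n (κ + 1)| ≤ b κ)
    (hb2 : ∀ κ, 1 / 2 * |(n κ : ℝ) - n (κ + 1)| + c * Real.sqrt (max (n κ : ℝ) (n (κ + 1))) - δ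
      ≤ b κ)
    (hC : C + ∑ κ ∈ Finset.Icc kmin kmax, d κ + ∑ κ ∈ Finset.Icc (kmin - 1) kmax, b κ ≤ 6 * N) :
    C ≤ 6 * N -
      min (3 / 5 * (N : ℝ))
        ((27 * (2 * Real.sqrt 3 + c - (δ + Real.sqrt 3 / (2 * Real.sqrt 31)) / Real.sqrt 31) ^ 2 *
            (3 - 2 * c / (2 * Real.sqrt 3 + c)) / 4) ^ ((1 : ℝ) / 3) * (N : ℝ) ^ ((2 : ℝ) / 3) -
          (2 * Real.sqrt 3 / c + c + 2 + (2 * Real.sqrt 3 + c) / (2 * c)) * Real.sqrt N) := by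
  set Λ := Finset.Icc kmin kmax with hΛ
  set I := Finset.Icc (kmin - 1) kmax with hI
  set ω₀ : ℝ := 2 * Real.sqrt 3 + c - (δ + Real.sqrt 3 / (2 * Real.sqrt 31)) / Real.sqrt 31 with hω₀
  set B : ℝ := 3 - 2 * c / (2 * Real.sqrt 3 + c) with hB
  set K' : ℝ := 2 * Real.sqrt 3 / c + c + 2 + (2 * Real.sqrt 3 + c) / (2 * c) with hK'
  have hs3 : 0 < Real.sqrt 3 := Real.sqrt_pos.2 (by norm_num)
  have hs31 : 0 < Real.sqrt 31 := Real.sqrt_pos.2 (by norm_num)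
  have hβpos : 0 < 2 * Real.sqrt 3 + c := by positivity
  have hBpos : 0 ≤ B := by
    rw [hB]
    have : 2 * c / (2 * Real.sqrt 3 + c) ≤ 2 := by
      rw [div_le_iff₀ hβpos]; nlinarith
    linarith
  have hK'pos : 0 ≤ K' := by rw [hK']; positivity
  -- `ω₀ ≥ 0`: `κ/√31 ≤ (2 + 1)/5 < 2√3`
  have h3lo : (1.7 : ℝ) ≤ Real.sqrt 3 := by
    rw [show (1.7 : ℝ) = Real.sqrt (1.7 ^ 2) by rw [Real.sqrt_sq (by norm_num)]]
    exact Real.sqrt_le_sqrt (by norm_num)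
  have h3hi : Real.sqrt 3 ≤ 1.8 := by
    rw [show (1.8 : ℝ) = Real.sqrt (1.8 ^ 2) by rw [Real.sqrt_sq (by norm_num)]]
    exact Real.sqrt_le_sqrt (by norm_num)
  have h31lo : (5.5 : ℝ) ≤ Real.sqrt 31 := by
    rw [show (5.5 : ℝ) = Real.sqrt (5.5 ^ 2) by rw [Real.sqrt_sq (by norm_num)]]
    exact Real.sqrt_le_sqrt (by norm_num)
  have hκ0 : 0 ≤ (δ + Real.sqrt 3 / (2 * Real.sqrt 31)) / Real.sqrt 31 := by positivity
  have hκle : (δ + Real.sqrt 3 / (2 * Real.sqrt 31)) / Real.sqrt 31 ≤ 1 := by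
    rw [div_le_iff₀ hs31]
    have : Real.sqrt 3 / (2 * Real.sqrt 31) ≤ 1 := by
      rw [div_le_iff₀ (by positivity)]; nlinarith
    nlinarith
  have hω₀pos : 0 ≤ ω₀ := by rw [hω₀]; nlinarith
  have hΛne : Λ.Nonempty := ⟨kmin, mem_Icc.2 ⟨le_rfl, hkk⟩⟩
  -- the largest layer
  obtain ⟨κ₀, hκ₀Λ, hκ₀⟩ := exists_max_image Λ n hΛne
  obtain ⟨M, hMdef⟩ : ∃ M : ℕ, n κ₀ = M := ⟨_, rfl⟩
  have hnM : ∀ κ, n κ ≤ M := by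
    intro κ
    by_cases hκ : κ ∈ Λ
    · exact hMdef ▸ hκ₀ κ hκ
    · have : n κ = 0 := by
        by_contra h
        exact hκ (mem_Icc.2 (hsupp κ h))
      simp [this]
  have hMN : M ≤ N := by
    rw [← hMdef, ← hsum]
    exact single_le_sum (fun κ _ => Nat.zero_le (n κ)) hκ₀Λ
  have hM1 : 1 ≤ M := by
    by_contra hM0
    have hz : ∀ κ ∈ Λ, n κ = 0 := fun κ _ => by have := hnM κ; omega
    have : ∑ κ ∈ Λ, n κ = 0 := sum_eq_zero hz
    omega
  have hM1r : (1 : ℝ) ≤ M := by exact_mod_cast hM1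
  have hMNr : (M : ℝ) ≤ N := by exact_mod_cast hMN
  have hNr : (1 : ℝ) ≤ N := hM1r.trans hMNr
  have hsqN1 : 1 ≤ Real.sqrt N := by
    rw [show (1 : ℝ) = Real.sqrt 1 from Real.sqrt_one.symm]; exact Real.sqrt_le_sqrt hNr
  -- the interface terms are nonnegative
  have hb0 : ∀ κ, 0 ≤ b κ := fun κ => le_trans (by positivity) (hb1 κ)
  have hsumb0 : 0 ≤ ∑ κ ∈ I, b κ := sum_nonneg fun κ _ => hb0 κ
  -- in-layer, through concavity: `∑ d ≥ (N/M)·√(12M − 3)`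
  have hsum_r : ∑ κ ∈ Λ, (n κ : ℝ) = N := by exact_mod_cast hsum
  have hdsum : (N : ℝ) * Real.sqrt (12 * M - 3) / M ≤ ∑ κ ∈ Λ, d κ := by
    have hper : ∀ κ ∈ Λ, (n κ : ℝ) * Real.sqrt (12 * M - 3) / M ≤ d κ := by
      intro κ _
      by_cases hκ : n κ = 0
      · rw [hκ, hd0 κ hκ]; simp
      · exact sqrt_layer_ge (by exact_mod_cast Nat.pos_of_ne_zero hκ)
          (by exact_mod_cast hnM κ) (hd κ).1 (hd κ).2
    calc (N : ℝ) * Real.sqrt (12 * M - 3) / M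
        = ∑ κ ∈ Λ, (n κ : ℝ) * Real.sqrt (12 * M - 3) / M := by
          rw [← sum_div, ← sum_mul, hsum_r]
      _ ≤ ∑ κ ∈ Λ, d κ := sum_le_sum hper
  have hKN : 0 ≤ K' * Real.sqrt N := by positivity
  rcases le_or_gt (M : ℝ) 30 with hM30 | hM31
  · -- few balls per layer: `∑ d ≥ 3N/5`
    have ht : 3 / 5 * (M : ℝ) ≤ Real.sqrt (12 * M - 3) := by
      have h := Real.sqrt_le_sqrt (show (3 / 5 * (M : ℝ)) ^ 2 ≤ 12 * M - 3 by nlinarith)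
      rwa [Real.sqrt_sq (by positivity)] at h
    have h35 : 3 / 5 * (N : ℝ) ≤ ∑ κ ∈ Λ, d κ := by
      refine le_trans ?_ hdsum
      rw [le_div_iff₀ (by linarith)]
      nlinarith
    have := min_le_left (3 / 5 * (N : ℝ))
      ((27 * ω₀ ^ 2 * B / 4) ^ ((1 : ℝ) / 3) * (N : ℝ) ^ ((2 : ℝ) / 3) - K' * Real.sqrt N)
    linarith
  · -- large layers: calibration
    have hM31n : 31 ≤ M := by
      have : (30 : ℝ) < (M : ℕ) := hM31
      have : 30 < M := by exact_mod_cast this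
      omega
    have hM31' : (31 : ℝ) ≤ M := by exact_mod_cast hM31n
    have hMpos : (0 : ℝ) < M := by linarith
    -- calibration at every interface
    have hcal : ∀ κ, Psi2 c δ M (n κ) / 2 + Psi2 c δ M (n (κ + 1)) / 2 +
        |G c δ M (n κ) - G c δ M (n (κ + 1))| ≤ b κ := by
      intro κ
      have h := interface_calibration_cap (c := c) (δ := δ) (β := b κ) (M := M) (p := n κ)
        (q := n (κ + 1)) (θ := thetaW c δ M) (Ψ := Psi c δ M) (Ψ₂ := Psi2 c δ M) hc hδ hδ2
        (hnM κ) (hnM (κ + 1)) (fun x => thetaW_nonneg hc δ M x)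
        (fun x hx hxM => thetaW_cap hc hc2 hδ hδc hM31n hx hxM)
        (fun x y hxy hyM => thetaW_mul_le_Psi_sub hc hc2 hδ hδc hM31n hxy hyM)
        (fun x => Psi2_le hc δ M x)
        (fun x y hxy hyM => G_mono hc hc2 hδ hδc hM31n hxy hyM) (hb1 κ) (hb2 κ)
      exact h
    have hsum_cal : ∑ κ ∈ I, (Psi2 c δ M (n κ) / 2 + Psi2 c δ M (n (κ + 1)) / 2 +
        |G c δ M (n κ) - G c δ M (n (κ + 1))|) ≤ ∑ κ ∈ I, b κ := sum_le_sum fun κ _ => hcal κ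
    -- the `Ψ₂`-halves collect EXACTLY to `∑_Λ Ψ₂(n)` (empty layers outside `Λ`, `Ψ₂(0) = 0`)
    have hn_lo : n (kmin - 1) = 0 := by
      by_contra h; have := (hsupp _ h).1; omega
    have hn_hi : n (kmax + 1) = 0 := by
      by_contra h; have := (hsupp _ h).2; omega
    have hi : ∑ κ ∈ I, Psi2 c δ M (n κ) = ∑ κ ∈ Λ, Psi2 c δ M (n κ) := by
      rw [hI, hΛ]
      have hsplit : Finset.Icc (kmin - 1) kmax = insert (kmin - 1) (Finset.Icc kmin kmax) := by
        ext κ; simp only [mem_insert, mem_Icc]; omega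
      rw [hsplit, sum_insert (by simp)]
      rw [hn_lo, Psi2_zero, zero_add]
    have hii : ∑ κ ∈ I, Psi2 c δ M (n (κ + 1)) = ∑ κ ∈ Λ, Psi2 c δ M (n κ) := by
      have e : ∑ κ ∈ I, Psi2 c δ M (n (κ + 1)) =
          ∑ κ ∈ Finset.Icc (kmin - 1 + 1) (kmax + 1), Psi2 c δ M (n κ) := by
        rw [← Finset.map_add_right_Icc, Finset.sum_map]; rfl
      rw [e, sub_add_cancel, hΛ]
      have hsplit : Finset.Icc kmin (kmax + 1) = insert (kmax + 1) (Finset.Icc kmin kmax) := by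
        ext κ; simp only [mem_insert, mem_Icc]; omega
      rw [hsplit, sum_insert (by simp)]
      rw [hn_hi, Psi2_zero, zero_add]
    -- the total variation of `G ∘ n` through the largest layer
    have htv : 2 * G c δ M M ≤ ∑ κ ∈ I, |G c δ M (n κ) - G c δ M (n (κ + 1))| := by
      set L' : ℕ := (kmax - kmin + 2).toNat with hL'
      set g : ℕ → ℝ := fun j => G c δ M (n (kmin - 1 + j)) with hg
      have hre : ∑ κ ∈ I, |G c δ M (n κ) - G c δ M (n (κ + 1))| =
          ∑ j ∈ Finset.range L', |g (j + 1) - g j| := by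
        refine Finset.sum_nbij' (fun κ => (κ - (kmin - 1)).toNat) (fun j => kmin - 1 + (j : ℤ))
          ?_ ?_ ?_ ?_ ?_
        · intro κ hκ; have := mem_Icc.1 hκ; rw [Finset.mem_range]; omega
        · intro j hj; rw [Finset.mem_range] at hj; rw [mem_Icc]; omega
        · intro κ hκ; have := mem_Icc.1 hκ; omega
        · intro j hj; omega
        · intro κ hκ
          have hκ' := mem_Icc.1 hκ
          have e1 : kmin - 1 + (((κ - (kmin - 1)).toNat : ℕ) : ℤ) = κ := by omega
          have e2 : kmin - 1 + (((κ - (kmin - 1)).toNat + 1 : ℕ) : ℤ) = κ + 1 := by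
            push_cast; omega
          simp only [hg, e1, e2]
          exact abs_sub_comm _ _
      rw [hre]
      have hj₀ : (κ₀ - (kmin - 1)).toNat ≤ L' := by have := mem_Icc.1 hκ₀Λ; omega
      have hg0 : g 0 = 0 := by
        simp only [hg, Nat.cast_zero, add_zero, hn_lo]; exact G_zero c δ M
      have hgL : g L' = 0 := by
        have hnL : n (kmin - 1 + L') = 0 := by
          by_contra h; have := (hsupp _ h).2; omega
        simp only [hg, hnL]; exact G_zero c δ M
      have hgj : g ((κ₀ - (kmin - 1)).toNat) = G c δ M M := by
        have e1 : kmin - 1 + (((κ₀ - (kmin - 1)).toNat : ℕ) : ℤ) = κ₀ := by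
          have := mem_Icc.1 hκ₀Λ; omega
        simp only [hg, e1, hMdef]
      have htv' := two_mul_le_sum_abs_sub g hj₀ hg0 hgL
      rwa [hgj] at htv'
    -- per layer: `d + Ψ₂(n) ≥ ω n / √M`
    have hW : omega c δ M * (N : ℝ) / Real.sqrt M ≤ ∑ κ ∈ Λ, (d κ + Psi2 c δ M (n κ)) := by
      have hper : ∀ κ ∈ Λ, omega c δ M * (n κ : ℝ) / Real.sqrt M ≤ d κ + Psi2 c δ M (n κ) := by
        intro κ _
        by_cases hκ : n κ = 0
        · rw [hd0 κ hκ, hκ, Psi2_zero]; simp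
        · exact layer_identity c δ M (Nat.pos_of_ne_zero hκ) (hd κ).1 (hd κ).2
      calc omega c δ M * (N : ℝ) / Real.sqrt M
          = ∑ κ ∈ Λ, omega c δ M * (n κ : ℝ) / Real.sqrt M := by
            rw [← sum_div, ← mul_sum, hsum_r]
        _ ≤ _ := sum_le_sum hper
    -- `ω ≥ ω₀`
    have hωge := omega_ge (c := c) hδ hM31n
    have hω₀le : ω₀ ≤ omega c δ M := by
      refine le_trans ?_ hωge
      rw [hω₀]
      have hsM : Real.sqrt 31 ≤ Real.sqrt M := Real.sqrt_le_sqrt hM31'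
      have : (δ + Real.sqrt 3 / (2 * Real.sqrt 31)) / Real.sqrt M ≤
          (δ + Real.sqrt 3 / (2 * Real.sqrt 31)) / Real.sqrt 31 :=
        div_le_div_of_nonneg_left (by positivity) hs31 hsM
      linarith
    -- value of the dual
    have hval := two_mul_G_top_ge hc hδ hδc hM31n
    -- assemble
    have hAM := rpow_le_div_sqrt_add_mul (N := (N : ℝ)) (M := (M : ℝ)) (ω := ω₀) (β := B)
      (by positivity) hMpos hω₀pos hBpos
    have hsqrtMN : Real.sqrt M ≤ Real.sqrt N := Real.sqrt_le_sqrt hMNr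
    have hsM0 : 0 ≤ Real.sqrt M := Real.sqrt_nonneg _
    have h1 : ∑ κ ∈ Λ, (d κ + Psi2 c δ M (n κ)) = ∑ κ ∈ Λ, d κ + ∑ κ ∈ Λ, Psi2 c δ M (n κ) :=
      sum_add_distrib
    have h2 : ∑ κ ∈ I, (Psi2 c δ M (n κ) / 2 + Psi2 c δ M (n (κ + 1)) / 2 +
        |G c δ M (n κ) - G c δ M (n (κ + 1))|) =
        (∑ κ ∈ I, Psi2 c δ M (n κ)) / 2 + (∑ κ ∈ I, Psi2 c δ M (n (κ + 1))) / 2 +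
          ∑ κ ∈ I, |G c δ M (n κ) - G c δ M (n (κ + 1))| := by
      rw [sum_add_distrib, sum_add_distrib, sum_div, sum_div]
    have hωN : ω₀ * (N : ℝ) / Real.sqrt M ≤ omega c δ M * (N : ℝ) / Real.sqrt M :=
      div_le_div_of_nonneg_right (mul_le_mul_of_nonneg_right hω₀le (by positivity))
        (Real.sqrt_nonneg _)
    have hK1 : (2 * Real.sqrt 3 / c + c) * Real.sqrt M ≤ (2 * Real.sqrt 3 / c + c) * Real.sqrt N :=
      mul_le_mul_of_nonneg_left hsqrtMN (by positivity)
    have hK0 : (2 + (2 * Real.sqrt 3 + c) / (2 * c)) ≤ (2 + (2 * Real.sqrt 3 + c) / (2 * c)) * Real.sqrt N :=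
      le_mul_of_one_le_right (by positivity) hsqN1
    have hmin := min_le_right (3 / 5 * (N : ℝ))
      ((27 * ω₀ ^ 2 * B / 4) ^ ((1 : ℝ) / 3) * (N : ℝ) ^ ((2 : ℝ) / 3) - K' * Real.sqrt N)
    have hK'e : K' * Real.sqrt N = (2 * Real.sqrt 3 / c + c) * Real.sqrt N +
        (2 + (2 * Real.sqrt 3 + c) / (2 * c)) * Real.sqrt N := by rw [hK']; ring
    linarith [hsum_cal, hi, hii, htv, hW, hval, hAM, hωN, hK1, hK0, h1, h2, hmin, hK'e, hdsum]


end Summit.Ventures.Crystal3D.Theorems.OptimalCalibration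

end
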